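import Mathlib
import Literature.MathematicalPhysics.QuantumFieldTheory.ConstructiveQFTWave0OddRPProofs
import Literature.MathematicalPhysics.QuantumFieldTheory.ConstructiveQFTWave0Proofs
import Literature.MathematicalPhysics.QuantumFieldTheory.LatticeGaugeProofs
import Literature.MathematicalPhysics.QuantumFieldTheory.LatticeGaugeStaticPotentialProofs
import HarnessLib

/-!
# Crux `stmt-QuantumFields-9442`, line `sup-axis-reflection-transfer`, stub `stub_rpCauchySchwarz`

Crux declaration: `Summit.QuantumFields.YangMills.Theses.FradkinShenkerFlow.FiniteSusceptibilityWeakCoupling`.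

**What is proved (STUB 2a of the lead's skeleton).** ASSUMING the uncentred odd-torus reflection
positivity in every plane (STUB 1, here the HYPOTHESIS `hRP`: for every bounded measurable real `F` on
`GaugeConfig 4 (2S+1) G` depending only on the links of the transported positive half,
`0 ≤ ∫ F(ΘU) F(U) dμ_{β,S}`, where `μ_{β,S} = wilsonMeasure ρ β` on the odd torus `(ℤ/(2S+1))⁴` and
`Θ = τ_v ∘ π_* ∘ Θ₀ ∘ π_*⁻¹ ∘ τ_{-v}` is the time reflection `Θ₀ = GaugeConfig.timeReflect` transported to
the plane `(π, v)` by the torus symmetries `torusConfigShift`, `configPerm`), we show that for two such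
observables `F, G'` the CENTRED form is positive semidefinite and satisfies the discriminant
Cauchy–Schwarz inequality:
`0 ≤ Cov(F∘Θ, F)`, `0 ≤ Cov(G'∘Θ, G')`, `Cov(F∘Θ, G')² ≤ Cov(F∘Θ, F) · Cov(G'∘Θ, G')`
(`ProbabilityTheory.covariance` with respect to `wilsonMeasure ρ β`).

**Proof.** (i) `Θ` is a measurable involution preserving `wilsonMeasure ρ β`: translations and axis
permutations preserve it (tree: `wilsonMeasure_map_torusConfigShift`, `wilsonMeasure_map_configPerm`),
and so does `Θ₀` (`wilsonMeasure_map_timeReflect` below, from the tree's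
`WilsonRP.measurePreserving_timeReflect` for the product Haar measure and `WilsonRP.plaqRe_timeReflect`
for the Wilson action, via `withDensity_map_of_measurableEquiv`). (ii) Abstractly, for a measurable
measure-preserving involution `Θ` of a finite measure space and a cone of bounded measurable functions
closed under `H + tK` on which `B(H, H) = ∫ H(Θω) H(ω) ≥ 0`, the form `B` is symmetric (substitute
`ω ↦ Θω`) and `t ↦ B(H + tK, H + tK) ≥ 0` is a quadratic polynomial, whence `B(H, K)² ≤ B(H, H) B(K, K)`
(`discrim_le_zero`). (iii) `E[F∘Θ] = E[F]`, so `Cov(F∘Θ, G') = B(F - E F, G' - E G')`, and constants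
depend on no link, so the centred observables stay in the cone.

The final theorem is stated with `Literature.MathematicalPhysics.QuantumFieldTheory` opened (short
names `GaugeConfig`, `Edge`, `sitePerm`, `torusConfigShift`, `configPerm`, `GaugeConfig.timeReflect`,
`wilsonMeasure`, `WilsonOddRP.IsOPosEdge/IsOSharedEdge`; torus sites keep their full name), which is
the registered stub text; the closing `example` re-checks it against the fully qualified skeleton text.
-/

open MeasureTheory ProbabilityTheory
open Literature.MathematicalPhysics.QuantumFieldTheory

noncomputable section

namespace Summit.QuantumFields.YangMills.Theorems.FiniteSusceptibilityWeakCoupling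

namespace RPCauchySchwarz

/-! ## Abstract part: a measure-preserving involution and a reflection-positive cone -/

section Abstract

variable {Ω : Type*} [MeasurableSpace Ω] {μ : Measure Ω} {Θ : Ω → Ω}

/-- Integrals are invariant under a measurable map preserving the measure. [folklore] -/
theorem integral_comp_eq (hΘm : Measurable Θ) (hΘμ : μ.map Θ = μ) {H : Ω → ℝ}
    (hH : Measurable H) : ∫ ω, H (Θ ω) ∂μ = ∫ ω, H ω ∂μ := by
  have h := integral_map (μ := μ) hΘm.aemeasurable (hH.aestronglyMeasurable (μ := μ.map Θ))
  rw [hΘμ] at h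
  exact h.symm

/-- The reflection form `B(H, K) = ∫ H(Θω) K(ω) dμ` of a measure-preserving involution `Θ` is
symmetric. [folklore] -/
theorem integral_mul_comp_comm (hΘm : Measurable Θ) (hΘμ : μ.map Θ = μ) (hΘΘ : ∀ ω, Θ (Θ ω) = ω)
    {H K : Ω → ℝ} (hH : Measurable H) (hK : Measurable K) :
    ∫ ω, H (Θ ω) * K ω ∂μ = ∫ ω, K (Θ ω) * H ω ∂μ := by
  have hm : Measurable fun ω => K (Θ ω) * H ω := (hK.comp hΘm).mul hH
  have h := integral_comp_eq hΘm hΘμ hm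
  simp only [hΘΘ] at h
  rw [← h]
  refine integral_congr_ae (ae_of_all _ fun ω => ?_)
  simp only [mul_comm]

/-- Products `A(Θω) B(ω)` of bounded measurable functions are integrable (finite measure). [folklore] -/
theorem integrable_comp_mul [IsFiniteMeasure μ] (hΘm : Measurable Θ) {A B : Ω → ℝ}
    (hA : Measurable A) (hB : Measurable B) {CA CB : ℝ} (hCA : ∀ ω, |A ω| ≤ CA)
    (hCB : ∀ ω, |B ω| ≤ CB) : Integrable (fun ω => A (Θ ω) * B ω) μ := by
  refine Integrable.of_bound ((hA.comp hΘm).mul hB).aestronglyMeasurable (CA * CB)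
    (ae_of_all _ fun ω => ?_)
  rw [Real.norm_eq_abs, abs_mul]
  exact mul_le_mul (hCA _) (hCB _) (abs_nonneg _) ((abs_nonneg _).trans (hCA (Θ ω)))

/-- Bilinear expansion of the reflection form along the pencil `H + tK`. [folklore] -/
theorem integral_pencil [IsFiniteMeasure μ] (hΘm : Measurable Θ) {H K : Ω → ℝ}
    (hH : Measurable H) (hK : Measurable K) {CH CK : ℝ} (hCH : ∀ ω, |H ω| ≤ CH)
    (hCK : ∀ ω, |K ω| ≤ CK) (t : ℝ) :
    ∫ ω, (H (Θ ω) + t * K (Θ ω)) * (H ω + t * K ω) ∂μ =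
      ∫ ω, H (Θ ω) * H ω ∂μ + t * ∫ ω, H (Θ ω) * K ω ∂μ + t * ∫ ω, K (Θ ω) * H ω ∂μ +
        t ^ 2 * ∫ ω, K (Θ ω) * K ω ∂μ := by
  have iA : Integrable (fun ω => H (Θ ω) * H ω) μ := integrable_comp_mul hΘm hH hH hCH hCH
  have iB : Integrable (fun ω => t * (H (Θ ω) * K ω)) μ :=
    (integrable_comp_mul hΘm hH hK hCH hCK).const_mul t
  have iB' : Integrable (fun ω => t * (K (Θ ω) * H ω)) μ :=
    (integrable_comp_mul hΘm hK hH hCK hCH).const_mul t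
  have iC : Integrable (fun ω => t ^ 2 * (K (Θ ω) * K ω)) μ :=
    (integrable_comp_mul hΘm hK hK hCK hCK).const_mul _
  have iAB : Integrable (fun ω => H (Θ ω) * H ω + t * (H (Θ ω) * K ω)) μ := iA.add iB
  have iABB : Integrable (fun ω => H (Θ ω) * H ω + t * (H (Θ ω) * K ω) + t * (K (Θ ω) * H ω)) μ :=
    iAB.add iB'
  have e : ∀ ω, (H (Θ ω) + t * K (Θ ω)) * (H ω + t * K ω) =
      H (Θ ω) * H ω + t * (H (Θ ω) * K ω) + t * (K (Θ ω) * H ω) + t ^ 2 * (K (Θ ω) * K ω) :=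
    fun ω => by ring
  simp_rw [e]
  rw [integral_add iABB iC, integral_add iAB iB', integral_add iA iB, integral_const_mul,
    integral_const_mul, integral_const_mul]

/-- **Abstract reflection-positivity Cauchy–Schwarz.** If `Θ` is a measurable measure-preserving
involution and `∫ H(Θω) H(ω) dμ ≥ 0` on a cone `D` of bounded measurable functions closed under
`H + tK`, then `(∫ H(Θω) K(ω))² ≤ (∫ H(Θω) H(ω)) (∫ K(Θω) K(ω))` on that cone. [folklore] -/
theorem sq_integral_le [IsFiniteMeasure μ] (hΘm : Measurable Θ) (hΘμ : μ.map Θ = μ)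
    (hΘΘ : ∀ ω, Θ (Θ ω) = ω) {D : (Ω → ℝ) → Prop}
    (hRP : ∀ H : Ω → ℝ, Measurable H → (∃ C : ℝ, ∀ ω, |H ω| ≤ C) → D H →
      0 ≤ ∫ ω, H (Θ ω) * H ω ∂μ)
    (hD : ∀ (H K : Ω → ℝ) (t : ℝ), D H → D K → D fun ω => H ω + t * K ω)
    {H K : Ω → ℝ} (hH : Measurable H) (hK : Measurable K) (hHb : ∃ C : ℝ, ∀ ω, |H ω| ≤ C)
    (hKb : ∃ C : ℝ, ∀ ω, |K ω| ≤ C) (hHD : D H) (hKD : D K) :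
    (∫ ω, H (Θ ω) * K ω ∂μ) ^ 2 ≤ (∫ ω, H (Θ ω) * H ω ∂μ) * ∫ ω, K (Θ ω) * K ω ∂μ := by
  obtain ⟨CH, hCH⟩ := hHb
  obtain ⟨CK, hCK⟩ := hKb
  have hsymm : ∫ ω, K (Θ ω) * H ω ∂μ = ∫ ω, H (Θ ω) * K ω ∂μ :=
    integral_mul_comp_comm hΘm hΘμ hΘΘ hK hH
  have hquad : ∀ t : ℝ, 0 ≤ (∫ ω, K (Θ ω) * K ω ∂μ) * (t * t) +
      (2 * ∫ ω, H (Θ ω) * K ω ∂μ) * t + ∫ ω, H (Θ ω) * H ω ∂μ := by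
    intro t
    have hm : Measurable fun ω => H ω + t * K ω := hH.add (hK.const_mul t)
    have hb : ∃ C : ℝ, ∀ ω, |H ω + t * K ω| ≤ C :=
      ⟨CH + |t| * CK, fun ω => (abs_add_le _ _).trans (add_le_add (hCH ω)
        (by rw [abs_mul]; exact mul_le_mul_of_nonneg_left (hCK ω) (abs_nonneg t)))⟩
    have h0 : 0 ≤ ∫ ω, (H (Θ ω) + t * K (Θ ω)) * (H ω + t * K ω) ∂μ :=
      hRP _ hm hb (hD H K t hHD hKD)
    rw [integral_pencil hΘm hH hK hCH hCK t, hsymm] at h0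
    exact h0.trans_eq (by ring)
  have hdisc := discrim_le_zero hquad
  rw [discrim] at hdisc
  nlinarith [hdisc]

/-- The covariance against a reflected observable is the reflection form of the centred
observables: `Cov(F∘Θ, G) = ∫ (F(Θω) - E F)(G(ω) - E G) dμ` (`Θ` measure preserving). [folklore] -/
theorem covariance_comp_eq (hΘm : Measurable Θ) (hΘμ : μ.map Θ = μ) {F : Ω → ℝ}
    (hF : Measurable F) (G : Ω → ℝ) :
    cov[fun ω => F (Θ ω), G; μ] = ∫ ω, (F (Θ ω) - ∫ x, F x ∂μ) * (G ω - ∫ x, G x ∂μ) ∂μ := by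
  rw [covariance, integral_comp_eq hΘm hΘμ hF]

/-- **Centred reflection positivity and Cauchy–Schwarz, abstract form.** For a measurable
measure-preserving involution `Θ` of a finite measure space and a cone `D` of functions closed under
`H + tK` and `H - c` on whose bounded measurable members `∫ H(Θω) H(ω) dμ ≥ 0`, the centred form
`(F, G) ↦ Cov(F∘Θ, G)` is positive semidefinite with the discriminant inequality. [folklore] -/
theorem covariance_rp_cauchySchwarz [IsFiniteMeasure μ] (hΘm : Measurable Θ) (hΘμ : μ.map Θ = μ)
    (hΘΘ : ∀ ω, Θ (Θ ω) = ω) {D : (Ω → ℝ) → Prop}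
    (hRP : ∀ H : Ω → ℝ, Measurable H → (∃ C : ℝ, ∀ ω, |H ω| ≤ C) → D H →
      0 ≤ ∫ ω, H (Θ ω) * H ω ∂μ)
    (hD : ∀ (H K : Ω → ℝ) (t : ℝ), D H → D K → D fun ω => H ω + t * K ω)
    (hDc : ∀ (H : Ω → ℝ) (c : ℝ), D H → D fun ω => H ω - c)
    {F G : Ω → ℝ} (hF : Measurable F) (hG : Measurable G) (hFb : ∃ C : ℝ, ∀ ω, |F ω| ≤ C)
    (hGb : ∃ C : ℝ, ∀ ω, |G ω| ≤ C) (hFD : D F) (hGD : D G) :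
    0 ≤ cov[fun ω => F (Θ ω), F; μ] ∧ 0 ≤ cov[fun ω => G (Θ ω), G; μ] ∧
      cov[fun ω => F (Θ ω), G; μ] ^ 2 ≤
        cov[fun ω => F (Θ ω), F; μ] * cov[fun ω => G (Θ ω), G; μ] := by
  obtain ⟨CF, hCF⟩ := hFb
  obtain ⟨CG, hCG⟩ := hGb
  have hF₀ : Measurable fun ω => F ω - ∫ x, F x ∂μ := hF.sub_const _
  have hG₀ : Measurable fun ω => G ω - ∫ x, G x ∂μ := hG.sub_const _
  have hF₀b : ∃ C : ℝ, ∀ ω, |F ω - ∫ x, F x ∂μ| ≤ C :=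
    ⟨CF + |∫ x, F x ∂μ|, fun ω => (abs_sub _ _).trans (add_le_add (hCF ω) le_rfl)⟩
  have hG₀b : ∃ C : ℝ, ∀ ω, |G ω - ∫ x, G x ∂μ| ≤ C :=
    ⟨CG + |∫ x, G x ∂μ|, fun ω => (abs_sub _ _).trans (add_le_add (hCG ω) le_rfl)⟩
  have hF₀D : D fun ω => F ω - ∫ x, F x ∂μ := hDc F _ hFD
  have hG₀D : D fun ω => G ω - ∫ x, G x ∂μ := hDc G _ hGD
  rw [covariance_comp_eq hΘm hΘμ hF F, covariance_comp_eq hΘm hΘμ hF G,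
    covariance_comp_eq hΘm hΘμ hG G]
  exact ⟨hRP _ hF₀ hF₀b hF₀D, hRP _ hG₀ hG₀b hG₀D,
    sq_integral_le hΘm hΘμ hΘΘ hRP hD hF₀ hG₀ hF₀b hG₀b hF₀D hG₀D⟩

/-- `DependsOn` is closed under the pencil operation `H + tK`. [folklore] -/
theorem dependsOn_add_mul {ι X : Type*} {s : Set ι} {H K : (ι → X) → ℝ} (hH : DependsOn H s)
    (hK : DependsOn K s) (t : ℝ) : DependsOn (fun ω => H ω + t * K ω) s := fun U V hUV => by
  show H U + t * K U = H V + t * K V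
  rw [hH hUV, hK hUV]

/-- `DependsOn` is closed under subtracting constants. [folklore] -/
theorem dependsOn_sub_const {ι X : Type*} {s : Set ι} {H : (ι → X) → ℝ} (hH : DependsOn H s)
    (c : ℝ) : DependsOn (fun ω => H ω - c) s := fun U V hUV => by
  show H U - c = H V - c
  rw [hH hUV]

end Abstract

/-! ## Lattice part: the transported reflection is a measure-preserving involution -/

section Lattice

variable {d L N : ℕ} {G : Type*}

/-- The time reflection `Θ₀` of torus gauge configurations is an involution. [folklore] -/
theorem timeReflect_timeReflect [NeZero d] [Group G] (U : GaugeConfig d L G) :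
    U.timeReflect.timeReflect = U := by
  funext e
  have h2 : (WilsonRP.edgeReflect e).2 = e.2 := by
    unfold WilsonRP.edgeReflect
    split_ifs with h
    · exact h.symm
    · rfl
  rw [WilsonRP.timeReflect_apply, WilsonRP.timeReflect_apply, h2, WilsonRP.edgeReflect_edgeReflect]
  split_ifs <;> simp

variable [MeasurableSpace G]

/-- `τ_{-v} ∘ τ_v = id` on torus configurations. [folklore] -/
theorem torusConfigShift_neg_shift (v : Site d L) (U : GaugeConfig d L G) :
    torusConfigShift (-v) (torusConfigShift v U) = U := by
  funext e
  simp

/-- `τ_v ∘ τ_{-v} = id` on torus configurations. [folklore] -/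
theorem torusConfigShift_shift_neg (v : Site d L) (U : GaugeConfig d L G) :
    torusConfigShift v (torusConfigShift (-v) U) = U := by
  funext e
  simp

/-- `π_* ∘ (π⁻¹)_* = id` on torus configurations. [folklore] -/
theorem configPerm_configPerm_symm (π : Equiv.Perm (Fin d)) (U : GaugeConfig d L G) :
    configPerm π (configPerm π.symm U) = U := by
  funext e
  simp only [configPerm_apply, Equiv.symm_symm, Equiv.apply_symm_apply]
  congr 1
  refine Prod.ext ?_ rfl
  funext j
  simp

/-- `(π⁻¹)_* ∘ π_* = id` on torus configurations. [folklore] -/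
theorem configPerm_symm_configPerm (π : Equiv.Perm (Fin d)) (U : GaugeConfig d L G) :
    configPerm π.symm (configPerm π U) = U := by
  simpa using configPerm_configPerm_symm π.symm U

variable [Group G]

/-- The transported reflection `Θ = τ_v ∘ π_* ∘ Θ₀ ∘ π_*⁻¹ ∘ τ_{-v}` is an involution. [folklore] -/
theorem theta_theta [NeZero d] (π : Equiv.Perm (Fin d)) (v : Site d L) (U : GaugeConfig d L G) :
    torusConfigShift v (configPerm π (GaugeConfig.timeReflect (configPerm π.symm
      (torusConfigShift (-v) (torusConfigShift v (configPerm π (GaugeConfig.timeReflect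
        (configPerm π.symm (torusConfigShift (-v) U))))))))) = U := by
  rw [torusConfigShift_neg_shift, configPerm_symm_configPerm, timeReflect_timeReflect,
    configPerm_configPerm_symm, torusConfigShift_shift_neg]

variable [TopologicalSpace G] [IsTopologicalGroup G] [BorelSpace G]

/-- The transported reflection `Θ` is measurable. [folklore] -/
theorem measurable_theta [NeZero d] (π : Equiv.Perm (Fin d)) (v : Site d L) :
    Measurable fun U : GaugeConfig d L G => torusConfigShift v (configPerm π
      (GaugeConfig.timeReflect (configPerm π.symm (torusConfigShift (-v) U)))) :=
  (torusConfigShift v).measurable.comp ((configPerm π).measurable.comp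
    (WilsonRP.measurable_timeReflect.comp ((configPerm π.symm).measurable.comp
      (torusConfigShift (-v)).measurable)))

variable [CompactSpace G] (ρ : G →* Matrix (Fin N) (Fin N) ℂ)

omit [MeasurableSpace G] [BorelSpace G] in
/-- The Wilson action is invariant under the time reflection `Θ₀` (any torus size): the reflected
holonomy of a plaquette has the real trace of the holonomy of the reflected plaquette
(`WilsonRP.plaqRe_timeReflect`), and `WilsonRP.plaqReflect` permutes the plaquettes. [folklore] -/
theorem wilsonAction_timeReflect [NeZero d] [NeZero L] (hρ : Continuous ρ) (U : GaugeConfig d L G) :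
    wilsonAction ρ U.timeReflect = wilsonAction ρ U := by
  -- adapted from `Summit.QuantumFields.QCD.Theorems.RobustYangMills.Negative.wilsonAction_timeReflect`
  unfold wilsonAction
  have h : ∀ p : Plaquette d L,
      (ρ (plaquetteHolonomy U.timeReflect p.1 p.2.1.1 p.2.1.2)).trace.re =
        (ρ (plaquetteHolonomy U (WilsonRP.plaqReflect p).1 (WilsonRP.plaqReflect p).2.1.1
          (WilsonRP.plaqReflect p).2.1.2)).trace.re :=
    fun p => WilsonRP.plaqRe_timeReflect ρ hρ U p
  simp_rw [h]
  exact Fintype.sum_equiv WilsonRP.plaqReflectEquiv _ _ (fun p => rfl)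

/-- **The torus Wilson state is invariant under the time reflection `Θ₀`**: the product Haar measure is
`Θ₀`-invariant (`WilsonRP.measurePreserving_timeReflect`) and so is the density `exp(-β S)`
(`wilsonAction_timeReflect`); combine with `withDensity_map_of_measurableEquiv`. [folklore] -/
theorem wilsonMeasure_map_timeReflect [NeZero d] [NeZero L] (hρ : Continuous ρ) (β : ℝ) :
    (wilsonMeasure (d := d) (L := L) ρ β).map GaugeConfig.timeReflect =
      wilsonMeasure (d := d) (L := L) ρ β := by
  have he : ⇑(MeasurableEquiv.ofInvolutive (GaugeConfig.timeReflect (d := d) (L := L) (G := G))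
      timeReflect_timeReflect WilsonRP.measurable_timeReflect) = GaugeConfig.timeReflect := rfl
  have hπ : (Measure.pi fun _ : Edge d L => haarProbability G).map
      (MeasurableEquiv.ofInvolutive (GaugeConfig.timeReflect (d := d) (L := L) (G := G))
        timeReflect_timeReflect WilsonRP.measurable_timeReflect) =
      Measure.pi fun _ : Edge d L => haarProbability G := by
    rw [he]
    exact (WilsonRP.measurePreserving_timeReflect (d := d) (L := L) (G := G)).map_eq
  rw [← he]
  simp only [wilsonMeasure, Measure.map_smul, wilsonWeight]
  rw [withDensity_map_of_measurableEquiv _ _ _ hπ]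
  intro U
  rw [he, wilsonAction_timeReflect ρ hρ]

/-- **The transported reflection `Θ` preserves the torus Wilson state** (composition of the
invariances under translations, axis permutations and `Θ₀`). [folklore] -/
theorem map_theta [NeZero d] [NeZero L] (hρ : Continuous ρ) (β : ℝ) (π : Equiv.Perm (Fin d))
    (v : Site d L) :
    (wilsonMeasure (d := d) (L := L) ρ β).map (fun U => torusConfigShift v (configPerm π
      (GaugeConfig.timeReflect (configPerm π.symm (torusConfigShift (-v) U))))) =
      wilsonMeasure (d := d) (L := L) ρ β := by
  have hsh : ∀ w : Site d L, MeasurePreserving (torusConfigShift w)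
      (wilsonMeasure (d := d) (L := L) ρ β) (wilsonMeasure (d := d) (L := L) ρ β) :=
    fun w => ⟨(torusConfigShift w).measurable, wilsonMeasure_map_torusConfigShift ρ β w⟩
  have hcp : ∀ σ : Equiv.Perm (Fin d), MeasurePreserving (configPerm σ)
      (wilsonMeasure (d := d) (L := L) ρ β) (wilsonMeasure (d := d) (L := L) ρ β) :=
    fun σ => ⟨(configPerm σ).measurable, wilsonMeasure_map_configPerm ρ hρ β σ⟩
  have htr : MeasurePreserving GaugeConfig.timeReflect
      (wilsonMeasure (d := d) (L := L) ρ β) (wilsonMeasure (d := d) (L := L) ρ β) :=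
    ⟨WilsonRP.measurable_timeReflect, wilsonMeasure_map_timeReflect ρ hρ β⟩
  exact ((hsh v).comp ((hcp π).comp (htr.comp ((hcp π.symm).comp (hsh (-v)))))).map_eq

end Lattice

end RPCauchySchwarz

/-- **STUB 2a (`stub_rpCauchySchwarz`) of line `sup-axis-reflection-transfer` for crux
`stmt-QuantumFields-9442`.** Assuming the uncentred odd-torus reflection positivity in every plane
(`0 ≤ ∫ F(ΘU) F(U) dμ_{β,S}` for bounded measurable real `F` depending only on the transported positive
half, `Θ = τ_v ∘ π_* ∘ Θ₀ ∘ π_*⁻¹ ∘ τ_{-v}`), the centred form `(F, G') ↦ Cov(F∘Θ, G')` on such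
observables is positive semidefinite and satisfies the discriminant Cauchy–Schwarz inequality:
`0 ≤ Cov(F∘Θ, F)`, `0 ≤ Cov(G'∘Θ, G')`, `Cov(F∘Θ, G')² ≤ Cov(F∘Θ, F) · Cov(G'∘Θ, G')`. Centring
(`Θ` preserves `wilsonMeasure ρ β`, constants depend on no link), symmetry (`Θ` is a measure-preserving
involution) and the discriminant of `t ↦ ∫ H_t(ΘU) H_t(U) ≥ 0`, `H_t = (F - E F) + t (G' - E G')`.
[folklore] -/
theorem stub_rpCauchySchwarz : (∀ (G : Type) [Group G] [TopologicalSpace G] [IsTopologicalGroup G] [CompactSpace G] [MeasurableSpace G] [BorelSpace G] (N : ℕ) (ρ : G →* Matrix (Fin N) (Fin N) ℂ), Continuous ρ → ∀ (β : ℝ), 0 ≤ β → ∀ (S : ℕ), 1 ≤ S → ∀ (π : Equiv.Perm (Fin 4)) (v : Literature.MathematicalPhysics.QuantumFieldTheory.Site 4 (2 * S + 1)) (F : GaugeConfig 4 (2 * S + 1) G → ℝ), Measurable F → (∃ C : ℝ, ∀ U, |F U| ≤ C) → DependsOn F {e : Edge 4 (2 * S + 1) | WilsonOddRP.IsOPosEdge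 (sitePerm π.symm (e.1 - v), π.symm e.2) ∨ WilsonOddRP.IsOSharedEdge (sitePerm π.symm (e.1 - v), π.symm e.2)} → 0 ≤ ∫ U, F (torusConfigShift v (configPerm π (GaugeConfig.timeReflect (configPerm π.symm (torusConfigShift (-v) U))))) * F U ∂(wilsonMeasure (d := 4) (L := 2 * S + 1) ρ β)) → ∀ (G : Type) [Group G] [TopologicalSpace G] [IsTopologicalGroup G] [CompactSpace G] [MeasurableSpace G] [BorelSpace G] (N : ℕ) (ρ : G →* Matrix (Fin N) (Fin N) ℂ), Continuous ρ → ∀ (β : ℝ), 0 ≤ β → ∀ (S : ℕ), 1 ≤ S → ∀ (π : Equiv.Perm (Fin 4)) (v : Literature.MathematicalPhysics.QuantumFieldTheory.Site 4 (2 * S + 1)) (F G' : GaugeConfig 4 (2 * S + 1) G → ℝ), Measurable F → Measurable G' → (∃ C : ℝ, ∀ U, |F U| ≤ C) → (∃ C : ℝ, ∀ U, |G' U| ≤ C) → DependsOn F {e : Edge 4 (2 * S + 1) | WilsonOddRP.IsOPosEdge (sitePerm π.symm (e.1 - v), π.symm e.2) ∨ WilsonOddRP.IsOSharedEdge (sitePerm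 π.symm (e.1 - v), π.symm e.2)} → DependsOn G' {e : Edge 4 (2 * S + 1) | WilsonOddRP.IsOPosEdge (sitePerm π.symm (e.1 - v), π.symm e.2) ∨ WilsonOddRP.IsOSharedEdge (sitePerm π.symm (e.1 - v), π.symm e.2)} → 0 ≤ ProbabilityTheory.covariance (fun U => F (torusConfigShift v (configPerm π (GaugeConfig.timeReflect (configPerm π.symm (torusConfigShift (-v) U)))))) F (wilsonMeasure (d := 4) (L := 2 * S + 1) ρ β) ∧ 0 ≤ ProbabilityTheory.covariance (fun U => G' (torusConfigShift v (configPerm π (GaugeConfig.timeReflect (configPerm π.symm (torusConfigShift (-v) U)))))) G' (wilsonMeasure (d := 4) (L := 2 * S + 1) ρ β) ∧ (ProbabilityTheory.covariance (fun U => F (torusConfigShift v (configPerm π (GaugeConfig.timeReflect (configPerm π.symm (torusConfigShift (-v) U)))))) G' (wilsonMeasure (d := 4) (L := 2 * S + 1) ρ β)) ^ 2 ≤ ProbabilityTheory.covariance (fun U => F (torusConfigShift v (configPerm π (GaugeConfig.timeReflect (configPerm π.symm (torusConfigShift (-v) U)))))) F (wilsonMeasure (d := 4) (L := 2 * S + 1)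 ρ β) * ProbabilityTheory.covariance (fun U => G' (torusConfigShift v (configPerm π (GaugeConfig.timeReflect (configPerm π.symm (torusConfigShift (-v) U)))))) G' (wilsonMeasure (d := 4) (L := 2 * S + 1) ρ β) := by
  intro hRP G _ _ _ _ _ _ N ρ hρ β hβ S hS π v F G' hF hG' hFb hG'b hFD hG'D
  haveI := isProbabilityMeasure_wilsonMeasure (d := 4) (L := 2 * S + 1) ρ hρ β
  exact RPCauchySchwarz.covariance_rp_cauchySchwarz
    (μ := wilsonMeasure (d := 4) (L := 2 * S + 1) ρ β)
    (Θ := fun U => torusConfigShift v (configPerm π (GaugeConfig.timeReflect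
      (configPerm π.symm (torusConfigShift (-v) U)))))
    (D := fun H : GaugeConfig 4 (2 * S + 1) G → ℝ => DependsOn H
      {e : Edge 4 (2 * S + 1) | WilsonOddRP.IsOPosEdge (sitePerm π.symm (e.1 - v), π.symm e.2) ∨
        WilsonOddRP.IsOSharedEdge (sitePerm π.symm (e.1 - v), π.symm e.2)})
    (RPCauchySchwarz.measurable_theta π v) (RPCauchySchwarz.map_theta ρ hρ β π v)
    (RPCauchySchwarz.theta_theta π v)
    (fun H hH hHb hHD => hRP G N ρ hρ β hβ S hS π v H hH hHb hHD)
    (fun H K t hH hK => RPCauchySchwarz.dependsOn_add_mul hH hK t)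
    (fun H c hH => RPCauchySchwarz.dependsOn_sub_const hH c)
    hF hG' hFb hG'b hFD hG'D

/-- Consistency check: `stub_rpCauchySchwarz` IS the lead's registered STUB 2a with every tree name
written out in full (the skeleton's §1 text, `work/stubs/sig_stub_rpCauchySchwarz.txt`); the theorem
above states it with the namespace `Literature.MathematicalPhysics.QuantumFieldTheory` opened (the
ledger caps registered stub signatures at 4000 characters), and the two elaborate to the identical
proposition. [folklore] -/
example : (∀ (G : Type) [Group G] [TopologicalSpace G] [IsTopologicalGroup G] [CompactSpace G] [MeasurableSpace G] [BorelSpace G] (N : ℕ) (ρ : G →* Matrix (Fin N) (Fin N) ℂ), Continuous ρ → ∀ (β : ℝ), 0 ≤ β → ∀ (S : ℕ), 1 ≤ S → ∀ (π : Equiv.Perm (Fin 4)) (v : Literature.MathematicalPhysics.QuantumFieldTheory.Site 4 (2 * S + 1)) (F : Literature.MathematicalPhysics.QuantumFieldTheory.GaugeConfig 4 (2 * S + 1) G → ℝ), Measurable F → (∃ C : ℝ, ∀ U, |F U| ≤ C) → DependsOn F {e : Literature.MathematicalPhysics.QuantumFieldTheory.Edge 4 (2 * S + 1) | Literature.MathematicalPhysics.QuantumFieldTheory.WilsonOddRP.IsOPosEdge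 (Literature.MathematicalPhysics.QuantumFieldTheory.sitePerm π.symm (e.1 - v), π.symm e.2) ∨ Literature.MathematicalPhysics.QuantumFieldTheory.WilsonOddRP.IsOSharedEdge (Literature.MathematicalPhysics.QuantumFieldTheory.sitePerm π.symm (e.1 - v), π.symm e.2)} → 0 ≤ ∫ U, F (Literature.MathematicalPhysics.QuantumFieldTheory.torusConfigShift v (Literature.MathematicalPhysics.QuantumFieldTheory.configPerm π (Literature.MathematicalPhysics.QuantumFieldTheory.GaugeConfig.timeReflect (Literature.MathematicalPhysics.QuantumFieldTheory.configPerm π.symm (Literature.MathematicalPhysics.QuantumFieldTheory.torusConfigShift (-v) U))))) * F U ∂(Literature.MathematicalPhysics.QuantumFieldTheory.wilsonMeasure (d := 4) (L := 2 * S + 1) ρ β)) → ∀ (G : Type) [Group G] [TopologicalSpace G] [IsTopologicalGroup G] [CompactSpace G] [MeasurableSpace G] [BorelSpace G] (N : ℕ) (ρ : G →* Matrix (Fin N) (Fin N) ℂ), Continuous ρ → ∀ (β : ℝ), 0 ≤ β → ∀ (S : ℕ), 1 ≤ S → ∀ (π : Equiv.Perm (Fin 4)) (v : Literature.MathematicalPhysics.QuantumFieldTheory.Site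 4 (2 * S + 1)) (F G' : Literature.MathematicalPhysics.QuantumFieldTheory.GaugeConfig 4 (2 * S + 1) G → ℝ), Measurable F → Measurable G' → (∃ C : ℝ, ∀ U, |F U| ≤ C) → (∃ C : ℝ, ∀ U, |G' U| ≤ C) → DependsOn F {e : Literature.MathematicalPhysics.QuantumFieldTheory.Edge 4 (2 * S + 1) | Literature.MathematicalPhysics.QuantumFieldTheory.WilsonOddRP.IsOPosEdge (Literature.MathematicalPhysics.QuantumFieldTheory.sitePerm π.symm (e.1 - v), π.symm e.2) ∨ Literature.MathematicalPhysics.QuantumFieldTheory.WilsonOddRP.IsOSharedEdge (Literature.MathematicalPhysics.QuantumFieldTheory.sitePerm π.symm (e.1 - v), π.symm e.2)} → DependsOn G' {e : Literature.MathematicalPhysics.QuantumFieldTheory.Edge 4 (2 * S + 1) | Literature.MathematicalPhysics.QuantumFieldTheory.WilsonOddRP.IsOPosEdge (Literature.MathematicalPhysics.QuantumFieldTheory.sitePerm π.symm (e.1 - v), π.symm e.2) ∨ Literature.MathematicalPhysics.QuantumFieldTheory.WilsonOddRP.IsOSharedEdge (Literature.MathematicalPhysics.QuantumFieldTheory.sitePerm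 π.symm (e.1 - v), π.symm e.2)} → 0 ≤ ProbabilityTheory.covariance (fun U => F (Literature.MathematicalPhysics.QuantumFieldTheory.torusConfigShift v (Literature.MathematicalPhysics.QuantumFieldTheory.configPerm π (Literature.MathematicalPhysics.QuantumFieldTheory.GaugeConfig.timeReflect (Literature.MathematicalPhysics.QuantumFieldTheory.configPerm π.symm (Literature.MathematicalPhysics.QuantumFieldTheory.torusConfigShift (-v) U)))))) F (Literature.MathematicalPhysics.QuantumFieldTheory.wilsonMeasure (d := 4) (L := 2 * S + 1) ρ β) ∧ 0 ≤ ProbabilityTheory.covariance (fun U => G' (Literature.MathematicalPhysics.QuantumFieldTheory.torusConfigShift v (Literature.MathematicalPhysics.QuantumFieldTheory.configPerm π (Literature.MathematicalPhysics.QuantumFieldTheory.GaugeConfig.timeReflect (Literature.MathematicalPhysics.QuantumFieldTheory.configPerm π.symm (Literature.MathematicalPhysics.QuantumFieldTheory.torusConfigShift (-v) U)))))) G' (Literature.MathematicalPhysics.QuantumFieldTheory.wilsonMeasure (d := 4) (L := 2 * S + 1) ρ β) ∧ (ProbabilityTheory.covariance (fun U => F (Literature.MathematicalPhysics.QuantumFieldTheory.torusConfigShift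 v (Literature.MathematicalPhysics.QuantumFieldTheory.configPerm π (Literature.MathematicalPhysics.QuantumFieldTheory.GaugeConfig.timeReflect (Literature.MathematicalPhysics.QuantumFieldTheory.configPerm π.symm (Literature.MathematicalPhysics.QuantumFieldTheory.torusConfigShift (-v) U)))))) G' (Literature.MathematicalPhysics.QuantumFieldTheory.wilsonMeasure (d := 4) (L := 2 * S + 1) ρ β)) ^ 2 ≤ ProbabilityTheory.covariance (fun U => F (Literature.MathematicalPhysics.QuantumFieldTheory.torusConfigShift v (Literature.MathematicalPhysics.QuantumFieldTheory.configPerm π (Literature.MathematicalPhysics.QuantumFieldTheory.GaugeConfig.timeReflect (Literature.MathematicalPhysics.QuantumFieldTheory.configPerm π.symm (Literature.MathematicalPhysics.QuantumFieldTheory.torusConfigShift (-v) U)))))) F (Literature.MathematicalPhysics.QuantumFieldTheory.wilsonMeasure (d := 4) (L := 2 * S + 1) ρ β) * ProbabilityTheory.covariance (fun U => G' (Literature.MathematicalPhysics.QuantumFieldTheory.torusConfigShift v (Literature.MathematicalPhysics.QuantumFieldTheory.configPerm π (Literature.MathematicalPhysics.QuantumFieldTheory.GaugeConfig.timeReflect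 (Literature.MathematicalPhysics.QuantumFieldTheory.configPerm π.symm (Literature.MathematicalPhysics.QuantumFieldTheory.torusConfigShift (-v) U)))))) G' (Literature.MathematicalPhysics.QuantumFieldTheory.wilsonMeasure (d := 4) (L := 2 * S + 1) ρ β) :=
  stub_rpCauchySchwarz

end Summit.QuantumFields.YangMills.Theorems.FiniteSusceptibilityWeakCoupling

end
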